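import Literature.ComputerArithmetic.BlanchardHighamMary2020.FABsum
import Literature.ComputerArithmetic.HallmanIpsen2023.MartingaleBounds

/-!
# Higham–Mary (2020), §2.1: probabilistic backward error analysis of recursive summation under
# MEAN INDEPENDENCE of the rounding errors (Model 1, Lemma 2.1, Theorem 2.4)

N. J. Higham, T. Mary, *Sharper probabilistic backward error analysis for basic linear algebra
kernels with random data*, SIAM J. Sci. Comput. 42 (5) (2020) A3427–A3446,
doi:10.1137/20M1314355 — Section 2 up to and including Theorem 2.4 ("Before deriving our new
results based on a probabilistic model of the data, we obtain a stronger version of a result from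
our previous paper [HighamMary2019, Thm. 3.1], using the less restrictive Model 1"):

* MODEL 1 (probabilistic model of rounding errors): the rounding errors `δ_1, δ_2, …` of the
  computation are random variables of mean zero with `E(δ_k | δ_1, …, δ_{k−1}) = E(δ_k) = 0`
  (MEAN INDEPENDENCE — weaker than independence), `|δ_k| ≤ u`. This is, verbatim, the tree's
  `ConnollyHighamMary2021.SRErrorModel μ u δ` (measurable `δ_k`, `|δ_k| ≤ u`, and
  `E[g(δ_0,…,δ_{k−1}) δ_k] = 0` for every bounded measurable test function `g` of the earlier
  rounding errors — the test-function form of `E(δ_k | δ_1,…,δ_{k−1}) = 0`), already used in this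
  form for Hallman–Ipsen's martingale analysis; we do not introduce a second name for it.
* eq. (2.2): the backward error of an approximate sum, `ε_bwd(ŝ) = |ŝ − s| / Σ_j |x_j|`
  (Oettli–Prager) — the tree's `BlanchardHighamMary2020.backwardError` / `IsBackwardSum`; here
  `isBackwardSum_of_abs_sub_le` (`|ŝ − s| ≤ ε Σ|x_j|` gives a backward error `≤ ε`, INCLUDING the
  all-zero data case).
* LEMMA 2.1: `ŝ − s = Σ_i T_i δ_i + O(u²)`, `T_i = Σ_{j≤i} x_j`, via the EXACT identity (2.5)
  `ŝ − s = Σ_i (T̂_{i−1} + x_i) δ_i = Σ_i T̂_i δ_i/(1 + δ_i)` (`recSum_sub_sum_eq`,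
  `errCoef_succ_mul_eq_div`); the `O(u²)` of (2.3) is made EXPLICIT:
  `ŝ − s = Σ_i T_i δ_i + Σ_i (T̂_{i−1} − T_{i−1}) δ_i` (`recSum_sub_sum_eq_dataCoef_add_remCoef`)
  with `|Σ_i (T̂_{i−1} − T_{i−1}) δ_i| ≤ n ((1+u)^{n−1} − 1) (Σ_j |x_j|) u` (`abs_sum_remCoef_mul_le`,
  a quantity `≤ n(n−1) u² (1+u)^{n−2} Σ_j |x_j|`).
* eq. (2.7)–(2.8): `T̂_i = Σ_{j≤i} x_j Π_ℓ (1 + δ_ℓ)` (the tree's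
  `BlanchardHighamMary2020.recSum_eq_sum_mul_recFactor`) and `|T̂_i| ≤ (1+u)^{#additions} Σ_{j≤i} |x_j|`
  (`abs_recSum_le`); the increment bounds `c_k` of the proof (`coefBound`, `abs_errCoef_le`,
  `sum_sq_coefBound_mul_le`).
* DEFINITION 2.2 (martingale) / LEMMA 2.3 (Azuma–Hoeffding): the tree's
  `HallmanIpsen2023.IsPredictable` / `transform` / `azumaHoeffding` (the Azuma–Hoeffding inequality
  for martingale transforms `Σ_k a_k δ_k` of a mean-independent bounded sequence by predictable,
  surely bounded coefficients — exactly the martingale `E_k = Σ_{i≤k} (T̂_{i−1} + x_i) δ_i` of the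
  proof of Theorem 2.4: `isPredictable_errCoef`, `recSum_sub_sum_eq_transform` = eq. (2.10)).
* THEOREM 2.4: under Model 1, `|ŝ − s| ≤ λ √(n−1) u (1+u)^{n−2} Σ_{j=1}^n |x_j|` with probability
  at least `1 − 2 exp(−λ²/2)` (`recSum_probErrorBound`), and the backward error bound it yields
  with (2.2), `ε_bwd(ŝ) ≤ λ √(n−1) u (1+u)^{n−2}` with the same probability
  (`recSum_probBackwardError`; the text's first-order reading `λ √(n−1) u + O(u²)`).

INDEXING (the tree's `Higham2002.recSum`): the data are `x_0, …, x_n` (`n + 1` summands, the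
source's `n`), `ŝ_0 = x_0`, `ŝ_k = (ŝ_{k−1} + x_k)(1 + δ_k)` for `k = 1, …, n` (`n` additions, the
source's `n − 1`; the source's `δ_1 = 0` is our unused `δ_0`). So the source's `√(n−1)`,
`(1+u)^{n−2}`, `Σ_{j=1}^n` read `√n`, `(1+u)^{n−1}`, `Σ_{i ∈ range (n+1)}` below, and the
source's `T̂_{i−1} + x_i` at `δ_i` (`i = 2, …, n`) is `errCoef x δ k = ŝ_{k−1} + x_k` at `δ_k`
(`k = 1, …, n`; `errCoef x δ 0 = 0`).

PROBABILITY is typed as in the tree's other probabilistic rounding-error analyses: "the inequality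
`|e| ≤ B` holds with probability at least `1 − p`" is `μ {ω | B < |e ω|} ≤ ENNReal.ofReal p` for a
probability measure `μ` on the sample space carrying the rounding errors `δ_k : Ω → ℝ`.

NOT typed here: §2.2 (Models 2 and 3 of random data, Lemmas 2.5–2.9, Theorem 2.8, Corollary 2.10 —
the sharper bounds for random data), §3 (inner products, matrix–vector and matrix–matrix
products), §4 (solution of linear systems), §5 (numerical experiments).
-/

namespace Literature.ComputerArithmetic.HighamMary2020

open MeasureTheory ProbabilityTheory Finset Real
open scoped NNReal ENNReal

open Literature.ComputerArithmetic.Higham2002 (recSum abs_recSum_sub_sum_le)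
open Literature.ComputerArithmetic.BlanchardHighamMary2020 (IsBackwardSum backwardError
  isBackwardSum_backwardError)
open Literature.ComputerArithmetic.ConnollyHighamMary2021 (SRErrorModel)
open Literature.ComputerArithmetic.HallmanIpsen2023 (IsPredictable transform azumaHoeffding
  azumaRadius u_nonneg)

/-! ### LEMMA 2.1: the rounding error of recursive summation as a sum over the rounding errors -/

section Algebra

variable {K : Type*} [Field K] [LinearOrder K] [IsStrictOrderedRing K]

/-- The COEFFICIENT PROCESS of the error of recursive summation: the multiplier `T̂_{k−1} + x_k` of
the `k`-th rounding error (`k ≥ 1`; `0` at the unused index `0`), where `T̂_{k−1} = ŝ_{k−1}` is the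
computed partial sum. [cite: HighamMary2020, §2.1, Lemma 2.1, eq. (2.5) (`(T̂_{i−1} + x_i) δ_i`) and
proof of Theorem 2.4 (`E_k = Σ_{i≤k} (T̂_{i−1} + x_i) δ_i`)] -/
def errCoef (x δ : ℕ → K) : ℕ → K
  | 0 => 0
  | k + 1 => recSum x δ k + x (k + 1)

omit [LinearOrder K] [IsStrictOrderedRing K] in
/-- **LEMMA 2.1, the exact identity (2.5):** `ŝ − s = T̂_n − T_n = Σ_k (T̂_{k−1} + x_k) δ_k`
(summing the recurrence (2.4) `T̂_k = (T̂_{k−1} + x_k)(1 + δ_k)`).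
[cite: HighamMary2020, §2.1, Lemma 2.1, eq. (2.5) (first equality) and eq. (2.10)] -/
theorem recSum_sub_sum_eq (x δ : ℕ → K) :
    ∀ n : ℕ, recSum x δ n - ∑ i ∈ range (n + 1), x i = ∑ k ∈ range (n + 1), errCoef x δ k * δ k
  | 0 => by simp [recSum, errCoef]
  | n + 1 => by
      rw [sum_range_succ x (n + 1), sum_range_succ (fun k => errCoef x δ k * δ k) (n + 1),
        ← recSum_sub_sum_eq x δ n]
      simp only [recSum, errCoef]
      ring

omit [LinearOrder K] [IsStrictOrderedRing K] in
/-- The second form of (2.5): `(T̂_{k−1} + x_k) δ_k = T̂_k δ_k / (1 + δ_k)`, by (2.4) (for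
`1 + δ_k ≠ 0`, automatic when `|δ_k| ≤ u < 1`).
[cite: HighamMary2020, §2.1, Lemma 2.1, eq. (2.5) (second equality, "using (2.4)")] -/
theorem errCoef_succ_mul_eq_div (x δ : ℕ → K) (k : ℕ) (h : 1 + δ (k + 1) ≠ 0) :
    errCoef x δ (k + 1) * δ (k + 1) = recSum x δ (k + 1) * δ (k + 1) / (1 + δ (k + 1)) := by
  simp only [errCoef, recSum]
  field_simp

/-- **Eq. (2.8): the computed partial sums are bounded**, `|T̂_k| ≤ (1+u)^{k} Σ_{i≤k} |x_i|`
(`k` = the number of additions performed; from (2.7), the tree's `recSum_eq_sum_mul_recFactor`,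
or directly from the worst-case bound `|T̂_k − T_k| ≤ ((1+u)^k − 1) Σ_{i≤k} |x_i|`).
[cite: HighamMary2020, §2.1, proof of Theorem 2.4, eqs. (2.7)–(2.8)] -/
theorem abs_recSum_le {u : K} (hu : 0 ≤ u) (x δ : ℕ → K) (hδ : ∀ k, |δ k| ≤ u) (k : ℕ) :
    |recSum x δ k| ≤ (1 + u) ^ k * ∑ i ∈ range (k + 1), |x i| := by
  have h1 := abs_recSum_sub_sum_le hu x δ hδ k
  have h2 : |∑ i ∈ range (k + 1), x i| ≤ ∑ i ∈ range (k + 1), |x i| := abs_sum_le_sum_abs _ _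
  calc |recSum x δ k|
      = |(recSum x δ k - ∑ i ∈ range (k + 1), x i) + ∑ i ∈ range (k + 1), x i| := by
        rw [sub_add_cancel]
    _ ≤ |recSum x δ k - ∑ i ∈ range (k + 1), x i| + |∑ i ∈ range (k + 1), x i| := abs_add_le _ _
    _ ≤ ((1 + u) ^ k - 1) * ∑ i ∈ range (k + 1), |x i| + ∑ i ∈ range (k + 1), |x i| :=
        add_le_add h1 h2
    _ = (1 + u) ^ k * ∑ i ∈ range (k + 1), |x i| := by ring

/-- The INCREMENT BOUNDS of the error martingale, `c_k / u`: `A_0 = 0` and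
`A_k = (1+u)^{k−1} Σ_{i≤k} |x_i|` (`k ≥ 1`), so that `|E_k − E_{k−1}| = |(T̂_{k−1} + x_k) δ_k| ≤ A_k u`.
[cite: HighamMary2020, §2.1, proof of Theorem 2.4, display after (2.9)
(`|E_k − E_{k−1}| ≤ u((1+u)^{k−2} Σ_{j≤k−1}|x_j| + |x_k|) ≤ u(1+u)^{k−2} Σ_{j≤k}|x_j| =: c_k`)] -/
def coefBound (u : K) (x : ℕ → K) : ℕ → K
  | 0 => 0
  | k + 1 => (1 + u) ^ k * ∑ i ∈ range (k + 2), |x i|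

omit [IsStrictOrderedRing K] in
/-- `A_k ≥ 0` when `1 + u ≥ 0`. [cite: HighamMary2020, §2.1, proof of Theorem 2.4 (`c_k`)] -/
theorem coefBound_nonneg [IsOrderedRing K] {u : K} (hu : 0 ≤ u) (x : ℕ → K) :
    ∀ k, 0 ≤ coefBound u x k
  | 0 => le_rfl
  | k + 1 => mul_nonneg (pow_nonneg (by positivity) _) (sum_nonneg fun _ _ => abs_nonneg _)

/-- **The increments of the error martingale are bounded:** `|T̂_{k−1} + x_k| ≤ A_k`, i.e.
`|E_k − E_{k−1}| ≤ c_k = A_k u`, from (2.8).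
[cite: HighamMary2020, §2.1, proof of Theorem 2.4, eq. (2.9) and the display after it] -/
theorem abs_errCoef_le {u : K} (hu : 0 ≤ u) (x δ : ℕ → K) (hδ : ∀ k, |δ k| ≤ u) :
    ∀ k, |errCoef x δ k| ≤ coefBound u x k
  | 0 => by simp [errCoef, coefBound]
  | k + 1 => by
      simp only [errCoef, coefBound]
      have h1 := abs_recSum_le hu x δ hδ k
      have hp : 1 ≤ (1 + u) ^ k := one_le_pow₀ (by linarith)
      calc |recSum x δ k + x (k + 1)| ≤ |recSum x δ k| + |x (k + 1)| := abs_add_le _ _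
        _ ≤ (1 + u) ^ k * ∑ i ∈ range (k + 1), |x i| + (1 + u) ^ k * |x (k + 1)| :=
            add_le_add h1 (le_mul_of_one_le_left (abs_nonneg _) hp)
        _ = (1 + u) ^ k * ∑ i ∈ range (k + 2), |x i| := by
            rw [sum_range_succ _ (k + 1), mul_add]

/-- `A_k ≤ (1+u)^{n−1} Σ_{i≤n} |x_i|` for every `k ≤ n` (so `Σ_{k≤n} c_k² ≤ n c_n²`, the
`√(n−1)`-step of the proof). [cite: HighamMary2020, §2.1, proof of Theorem 2.4, last display
(`|E_n − E_1| ≤ λ √(n−1) u (1+u)^{n−2} Σ_j |x_j|`)] -/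
theorem coefBound_le {u : K} (hu : 0 ≤ u) (x : ℕ → K) {k n : ℕ} (hk : k ≤ n) :
    coefBound u x k ≤ (1 + u) ^ (n - 1) * ∑ i ∈ range (n + 1), |x i| := by
  cases k with
  | zero =>
      show (0 : K) ≤ _
      exact mul_nonneg (pow_nonneg (by positivity) _) (sum_nonneg fun _ _ => abs_nonneg _)
  | succ j =>
      simp only [coefBound]
      have h1 : (1 + u) ^ j ≤ (1 + u) ^ (n - 1) := pow_le_pow_right₀ (by linarith) (by omega)
      have h2 : ∑ i ∈ range (j + 2), |x i| ≤ ∑ i ∈ range (n + 1), |x i| :=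
        sum_le_sum_of_subset_of_nonneg (range_subset_range.mpr (by omega)) (fun i _ _ => abs_nonneg _)
      exact mul_le_mul h1 h2 (sum_nonneg fun _ _ => abs_nonneg _) (pow_nonneg (by positivity) _)

/-- **The variance proxy of the Azuma–Hoeffding step:** `Σ_{k≤n} c_k² ≤ n (u (1+u)^{n−1} Σ_i |x_i|)²`.
[cite: HighamMary2020, §2.1, proof of Theorem 2.4, last display (Lemma 2.3 with
`(Σ_k c_k²)^{1/2} ≤ √(n−1) u (1+u)^{n−2} Σ_j |x_j|`)] -/
theorem sum_sq_coefBound_mul_le {u : K} (hu : 0 ≤ u) (x : ℕ → K) (n : ℕ) :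
    ∑ k ∈ range (n + 1), (coefBound u x k * u) ^ 2
      ≤ n * ((1 + u) ^ (n - 1) * (∑ i ∈ range (n + 1), |x i|) * u) ^ 2 := by
  set M := (1 + u) ^ (n - 1) * (∑ i ∈ range (n + 1), |x i|) * u with hM
  have hterm : ∀ k ∈ range n, (coefBound u x (k + 1) * u) ^ 2 ≤ M ^ 2 := by
    intro k hk
    have hk' : k + 1 ≤ n := mem_range.mp hk
    have h0 : 0 ≤ coefBound u x (k + 1) * u := mul_nonneg (coefBound_nonneg hu x _) hu
    exact pow_le_pow_left₀ h0 (mul_le_mul_of_nonneg_right (coefBound_le hu x hk') hu) 2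
  calc ∑ k ∈ range (n + 1), (coefBound u x k * u) ^ 2
      = ∑ k ∈ range n, (coefBound u x (k + 1) * u) ^ 2 := by
        rw [sum_range_succ']; simp [coefBound]
    _ ≤ ∑ k ∈ range n, M ^ 2 := sum_le_sum hterm
    _ = n * M ^ 2 := by rw [sum_const, card_range, nsmul_eq_mul]

omit [LinearOrder K] [IsStrictOrderedRing K] in
/-- The computed partial sum depends only on the rounding errors `δ_1, …, δ_k` already committed.
[cite: HighamMary2020, §2.1, proof of Theorem 2.4 ("`T̂_{k−1}` is completely determined by
`δ_1, …, δ_{k−1}`")] -/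
theorem recSum_congr (x : ℕ → K) {v w : ℕ → K} :
    ∀ k, (∀ j ≤ k, v j = w j) → recSum x v k = recSum x w k
  | 0, _ => rfl
  | k + 1, h => by
      simp only [recSum]
      rw [recSum_congr x k (fun j hj => h j (hj.trans (Nat.le_succ k))), h (k + 1) le_rfl]

/-! ### LEMMA 2.1, eq. (2.3): the first-order term `Σ_i T_i δ_i` and the explicit `O(u²)` remainder -/

/-- The DATA PARTIAL SUMS as a coefficient process: `0, T_1, T_2, …`, `T_k = Σ_{i≤k} x_i` — the
first-order multiplier of `δ_k`. [cite: HighamMary2020, §2.1, Lemma 2.1, eq. (2.3)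
(`ŝ − s = Σ_i T_i δ_i + O(u²)`, `T_i = Σ_{j≤i} x_j`)] -/
def dataCoef (x : ℕ → K) : ℕ → K
  | 0 => 0
  | k + 1 => ∑ i ∈ range (k + 2), x i

/-- The SECOND-ORDER coefficients `T̂_{k−1} − T_{k−1}` (the error already accumulated before step
`k`), carrying the `O(u²)` of (2.3): `(T̂_{k−1} + x_k) δ_k = T_k δ_k + (T̂_{k−1} − T_{k−1}) δ_k`.
[cite: HighamMary2020, §2.1, Lemma 2.1, proof ("`T̂_i δ_i/(1+δ_i) = (T_i + O(u)) δ_i/(1+δ_i)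
= T_i δ_i + O(u²)`")] -/
def remCoef (x δ : ℕ → K) : ℕ → K
  | 0 => 0
  | k + 1 => recSum x δ k - ∑ i ∈ range (k + 1), x i

omit [LinearOrder K] [IsStrictOrderedRing K] in
/-- `T̂_{k−1} + x_k = T_k + (T̂_{k−1} − T_{k−1})`. [cite: HighamMary2020, §2.1, Lemma 2.1, proof] -/
theorem errCoef_eq_dataCoef_add_remCoef (x δ : ℕ → K) :
    ∀ k, errCoef x δ k = dataCoef x k + remCoef x δ k
  | 0 => by simp [errCoef, dataCoef, remCoef]
  | k + 1 => by
      simp only [errCoef, dataCoef, remCoef]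
      rw [sum_range_succ _ (k + 1)]
      ring

omit [LinearOrder K] [IsStrictOrderedRing K] in
/-- **LEMMA 2.1, eq. (2.3) in exact form:** `ŝ − s = Σ_k T_k δ_k + Σ_k (T̂_{k−1} − T_{k−1}) δ_k`
— the first-order term of (2.3) plus an explicit remainder (bounded by `abs_sum_remCoef_mul_le`).
[cite: HighamMary2020, §2.1, Lemma 2.1, eq. (2.3)] -/
theorem recSum_sub_sum_eq_dataCoef_add_remCoef (x δ : ℕ → K) (n : ℕ) :
    recSum x δ n - ∑ i ∈ range (n + 1), x i
      = ∑ k ∈ range (n + 1), dataCoef x k * δ k + ∑ k ∈ range (n + 1), remCoef x δ k * δ k := by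
  rw [recSum_sub_sum_eq, ← sum_add_distrib]
  exact sum_congr rfl (fun k _ => by rw [errCoef_eq_dataCoef_add_remCoef, add_mul])

/-- `|T̂_{k−1} − T_{k−1}| ≤ ((1+u)^{k−1} − 1) Σ_{i≤k−1} |x_i|` — the `O(u)` in "`T̂_i = T_i + O(u)`"
made explicit by the worst-case bound. [cite: HighamMary2020, §2.1, Lemma 2.1, proof
("`T̂_i = T_i + O(u)`")] -/
theorem abs_remCoef_le {u : K} (hu : 0 ≤ u) (x δ : ℕ → K) (hδ : ∀ k, |δ k| ≤ u) :
    ∀ k, |remCoef x δ k| ≤ ((1 + u) ^ (k - 1) - 1) * ∑ i ∈ range k, |x i|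
  | 0 => by simp [remCoef]
  | k + 1 => by
      simp only [remCoef, Nat.add_sub_cancel]
      exact abs_recSum_sub_sum_le hu x δ hδ k

/-- **The `O(u²)` term of (2.3), explicitly:**
`|Σ_{k≤n} (T̂_{k−1} − T_{k−1}) δ_k| ≤ n ((1+u)^{n−1} − 1) (Σ_{i≤n} |x_i|) u`
(`≤ n(n−1) u² (1+u)^{n−2} Σ_i |x_i|`, second order in `u`).
[cite: HighamMary2020, §2.1, Lemma 2.1, eq. (2.3) (the `O(u²)` term)] -/
theorem abs_sum_remCoef_mul_le {u : K} (hu : 0 ≤ u) (x δ : ℕ → K) (hδ : ∀ k, |δ k| ≤ u) (n : ℕ) :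
    |∑ k ∈ range (n + 1), remCoef x δ k * δ k|
      ≤ n * (((1 + u) ^ (n - 1) - 1) * ∑ i ∈ range (n + 1), |x i|) * u := by
  set M := ((1 + u) ^ (n - 1) - 1) * ∑ i ∈ range (n + 1), |x i| with hM
  have h1u : (1 : K) ≤ 1 + u := by linarith
  have hM0 : 0 ≤ M :=
    mul_nonneg (sub_nonneg.mpr (one_le_pow₀ h1u)) (sum_nonneg fun _ _ => abs_nonneg _)
  have hterm : ∀ k ∈ range n, |remCoef x δ (k + 1) * δ (k + 1)| ≤ M * u := by
    intro k hk
    have hk' : k + 1 ≤ n := mem_range.mp hk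
    rw [abs_mul]
    refine mul_le_mul ?_ (hδ _) (abs_nonneg _) hM0
    calc |remCoef x δ (k + 1)| ≤ ((1 + u) ^ k - 1) * ∑ i ∈ range (k + 1), |x i| := by
          simpa using abs_remCoef_le hu x δ hδ (k + 1)
      _ ≤ M := by
          refine mul_le_mul ?_ ?_ (sum_nonneg fun _ _ => abs_nonneg _)
            (sub_nonneg.mpr (one_le_pow₀ h1u))
          · exact sub_le_sub_right (pow_le_pow_right₀ h1u (by omega)) 1
          · exact sum_le_sum_of_subset_of_nonneg (range_subset_range.mpr (by omega))
              (fun i _ _ => abs_nonneg _)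
  calc |∑ k ∈ range (n + 1), remCoef x δ k * δ k|
      = |∑ k ∈ range n, remCoef x δ (k + 1) * δ (k + 1)| := by
        rw [sum_range_succ']; simp [remCoef]
    _ ≤ ∑ k ∈ range n, |remCoef x δ (k + 1) * δ (k + 1)| := abs_sum_le_sum_abs _ _
    _ ≤ ∑ k ∈ range n, M * u := sum_le_sum hterm
    _ = n * M * u := by rw [sum_const, card_range, nsmul_eq_mul]; ring

/-! ### Eq. (2.2): the backward error of an approximate sum -/

/-- **Eq. (2.2) (Oettli–Prager for sums), as used to read off backward error bounds:** if
`|ŝ − s| ≤ ε Σ_j |x_j|` (`ε ≥ 0`) then `ŝ = Σ_j x_j (1 + θ_j)` with `|θ_j| ≤ ε`, i.e.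
`ε_bwd(ŝ) ≤ ε` — for data not all zero this is `backwardError ≤ ε` (the tree's
`isBackwardSum_backwardError`), and for all-zero data the hypothesis forces `ŝ = 0 = s`.
[cite: HighamMary2020, §2, eq. (2.2) (`ε_bwd(ŝ) = min{ε : ŝ = Σ x_j(1+θ_j), |θ_j| ≤ ε}
= |ŝ − s| / Σ_j |x_j|`)] -/
theorem isBackwardSum_of_abs_sub_le {ι : Type*} {s : Finset ι} {x : ι → K} {ŝ ε : K}
    (hε : 0 ≤ ε) (h : |ŝ - ∑ i ∈ s, x i| ≤ ε * ∑ i ∈ s, |x i|) : IsBackwardSum s x ŝ ε := by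
  rcases (sum_nonneg (fun i (_ : i ∈ s) => abs_nonneg (x i))).eq_or_lt with h0 | hpos
  · -- all data vanish on `s`: the hypothesis forces `ŝ = 0`
    have hx : ∀ i ∈ s, x i = 0 := fun i hi =>
      abs_eq_zero.mp (le_antisymm
        ((single_le_sum (fun j (_ : j ∈ s) => abs_nonneg (x j)) hi).trans h0.symm.le)
        (abs_nonneg _))
    have hs : ∑ i ∈ s, x i = 0 := sum_eq_zero hx
    have hŝ : ŝ = 0 := by
      rw [hs, ← h0, sub_zero, mul_zero] at h
      exact abs_eq_zero.mp (le_antisymm h (abs_nonneg _))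
    refine ⟨fun _ => 0, fun _ _ => by simpa using hε, ?_⟩
    rw [hŝ]
    exact (sum_eq_zero (fun i hi => by simp [hx i hi])).symm
  · have hbe : backwardError s x ŝ ≤ ε := by
      unfold backwardError
      rwa [div_le_iff₀ hpos]
    exact (isBackwardSum_backwardError s x ŝ hpos).mono hbe

end Algebra

/-! ### THEOREM 2.4: the probabilistic bound under Model 1 (mean-independent rounding errors) -/

section Probabilistic

variable {Ω : Type*} [MeasurableSpace Ω] {μ : Measure Ω} {u : ℝ} {δ : ℕ → Ω → ℝ}

/-- The computed partial sums are random variables: `ω ↦ ŝ_k(ω)` is measurable when the data and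
the rounding errors are (the data may themselves be random, as in §2.2).
[cite: HighamMary2020, §2.1, Lemma 2.1, eq. (2.4) (the computed `T̂_i`) with Model 1
(the `δ_k` are random variables)] -/
theorem measurable_recSum_rv {ξ η : ℕ → Ω → ℝ} (hξ : ∀ i, Measurable (ξ i))
    (hη : ∀ i, Measurable (η i)) :
    ∀ k, Measurable (fun ω => recSum (fun i => ξ i ω) (fun i => η i ω) k)
  | 0 => by simpa [recSum] using hξ 0
  | k + 1 => by
      simp only [recSum]
      exact ((measurable_recSum_rv hξ hη k).add (hξ (k + 1))).mul
        (measurable_const.add (hη (k + 1)))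

/-- For fixed data, `T̂_k` is a measurable function of the rounding-error SEQUENCE.
[cite: HighamMary2020, §2.1, proof of Theorem 2.4 ("`T̂_{k−1}` is completely determined by
`δ_1, …, δ_{k−1}`")] -/
theorem measurable_recSum (x : ℕ → ℝ) (k : ℕ) : Measurable (fun v : ℕ → ℝ => recSum x v k) :=
  measurable_recSum_rv (Ω := ℕ → ℝ) (ξ := fun i _ => x i) (η := fun i v => v i)
    (fun _ => measurable_const) (fun i => measurable_pi_apply i) k

omit [MeasurableSpace Ω] in
/-- **`E_k` is a martingale with respect to `δ_1, …, δ_n`:** the coefficient process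
`T̂_{k−1} + x_k` is PREDICTABLE — a measurable function of the earlier rounding errors
`δ_1, …, δ_{k−1}` only — which, with the mean independence of Model 1, is the martingale property
`E(E_k | δ_1, …, δ_{k−1}) = E_{k−1}`.
[cite: HighamMary2020, §2.1, proof of Theorem 2.4 ("we have proved that `E_1, …, E_n` is a
martingale with respect to `δ_1, …, δ_n`")] -/
theorem isPredictable_errCoef (x : ℕ → ℝ) :
    IsPredictable δ (fun k ω => errCoef x (fun i => δ i ω) k) := by
  intro k
  cases k with
  | zero => exact ⟨fun _ => 0, measurable_const, fun _ _ _ => rfl, fun _ => rfl⟩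
  | succ k =>
      refine ⟨fun v => recSum x v k + x (k + 1), (measurable_recSum x k).add measurable_const,
        fun v w hvw => ?_, fun _ => rfl⟩
      show recSum x v k + x (k + 1) = recSum x w k + x (k + 1)
      rw [recSum_congr x k (fun j hj => hvw j (Set.mem_Iio.mpr (Nat.lt_succ_of_le hj)))]

omit [MeasurableSpace Ω] in
/-- **Eq. (2.10):** the rounding error of recursive summation IS the martingale (transform)
`E_n = Σ_k (T̂_{k−1} + x_k) δ_k` evaluated at the realised rounding errors.
[cite: HighamMary2020, §2.1, proof of Theorem 2.4, eq. (2.10) (`ŝ − s = E_n − E_1`)] -/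
theorem recSum_sub_sum_eq_transform (x : ℕ → ℝ) (δ : ℕ → Ω → ℝ) (n : ℕ) (ω : Ω) :
    recSum x (fun i => δ i ω) n - ∑ i ∈ range (n + 1), x i
      = transform (fun k ω => errCoef x (fun i => δ i ω) k) δ (n + 1) ω := by
  rw [transform, recSum_sub_sum_eq]

variable [IsProbabilityMeasure μ]

/-- **THEOREM 2.4 (Higham–Mary 2020): probabilistic error bound for recursive summation under
MODEL 1.** Let `s = Σ_{i=0}^n x_i` be computed by recursive summation (`n` additions) with rounding
errors that are mean independent with mean zero and bounded by `u` (Model 1 =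
`SRErrorModel μ u δ`). Then for every `λ > 0`, the inequality
`|ŝ − s| ≤ λ √n u (1+u)^{n−1} Σ_{i=0}^n |x_i|`
holds with probability at least `1 − 2 exp(−λ²/2)` — a failure probability independent of `n`.
(Source indexing: `n` summands, `λ √(n−1) u (1+u)^{n−2} Σ_{j=1}^n |x_j|`.) Proof as in the
source: Azuma–Hoeffding (the tree's `HallmanIpsen2023.azumaHoeffding`) for the martingale
`E_k = Σ_{i≤k} (T̂_{i−1} + x_i) δ_i` with increment bounds `c_k = u (1+u)^{k−1} Σ_{i≤k} |x_i|`.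
[cite: HighamMary2020, §2.1, Theorem 2.4, eq. (2.6)] -/
theorem recSum_probErrorBound (h : SRErrorModel μ u δ) (x : ℕ → ℝ) (n : ℕ) {lam : ℝ}
    (hlam : 0 < lam) :
    μ {ω | lam * Real.sqrt n * u * (1 + u) ^ (n - 1) * ∑ i ∈ range (n + 1), |x i|
        < |recSum x (fun i => δ i ω) n - ∑ i ∈ range (n + 1), x i|}
      ≤ ENNReal.ofReal (2 * Real.exp (-lam ^ 2 / 2)) := by
  have hu : 0 ≤ u := u_nonneg h
  set a : ℕ → Ω → ℝ := fun k ω => errCoef x (fun i => δ i ω) k with ha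
  set A : ℕ → ℝ := coefBound u x with hA
  have hP : IsPredictable δ a := isPredictable_errCoef x
  have hbd : ∀ k ω, |a k ω| ≤ A k := fun k ω => abs_errCoef_le hu x _ (fun i => h.bounded i ω) k
  set p : ℝ := 2 * Real.exp (-lam ^ 2 / 2) with hp
  have hp0 : 0 < p := by positivity
  set σsq : ℝ := ∑ k ∈ range (n + 1), (A k * u) ^ 2 with hσ
  set M : ℝ := (1 + u) ^ (n - 1) * (∑ i ∈ range (n + 1), |x i|) * u with hM
  have hM0 : 0 ≤ M := by positivity
  -- the Azuma–Hoeffding radius at failure probability `2 exp(−λ²/2)` is `λ (Σ_k c_k²)^{1/2}`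
  have hrad : azumaRadius σsq p = Real.sqrt σsq * lam := by
    unfold azumaRadius
    congr 1
    have h2p : 2 / p = Real.exp (lam ^ 2 / 2) := by
      rw [hp, show -lam ^ 2 / 2 = -(lam ^ 2 / 2) by ring, Real.exp_neg]
      field_simp
    rw [h2p, Real.log_exp, show 2 * (lam ^ 2 / 2) = lam ^ 2 by ring, Real.sqrt_sq hlam.le]
  -- `(Σ_k c_k²)^{1/2} ≤ √n u (1+u)^{n−1} Σ_i |x_i|`
  have hsq : Real.sqrt σsq ≤ Real.sqrt n * M := by
    calc Real.sqrt σsq ≤ Real.sqrt (n * M ^ 2) :=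
          Real.sqrt_le_sqrt (sum_sq_coefBound_mul_le hu x n)
      _ = Real.sqrt n * M := by rw [Real.sqrt_mul (Nat.cast_nonneg n), Real.sqrt_sq hM0]
  have hAz := azumaHoeffding h hP hbd (n + 1) hp0
  refine (measure_mono ?_).trans hAz
  intro ω hω
  simp only [Set.mem_setOf_eq] at hω ⊢
  rw [← hσ, hrad, ← recSum_sub_sum_eq_transform x δ n ω]
  refine lt_of_le_of_lt ?_ hω
  calc Real.sqrt σsq * lam ≤ Real.sqrt n * M * lam := mul_le_mul_of_nonneg_right hsq hlam.le
    _ = lam * Real.sqrt n * u * (1 + u) ^ (n - 1) * ∑ i ∈ range (n + 1), |x i| := by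
        rw [hM]; ring

/-- **THEOREM 2.4 with (2.2): the probabilistic BACKWARD ERROR bound under Model 1.** For every
`λ > 0`, with probability at least `1 − 2 exp(−λ²/2)` the computed sum is the exact sum of
relatively perturbed data, `ŝ = Σ_{i=0}^n x_i (1 + θ_i)` with `|θ_i| ≤ λ √n u (1+u)^{n−1}`; i.e.
`ε_bwd(ŝ) ≤ λ √n u (1+u)^{n−1}` (`= λ √(n−1) u + O(u²)` in the source's indexing).
[cite: HighamMary2020, §2.1, Theorem 2.4 with eq. (2.2) ("Combining Theorem 2.4 with the formula
(2.2) for the backward error we obtain the backward error bound `ε_bwd(ŝ) ≤ λ √(n−1) u + O(u²)`")] -/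
theorem recSum_probBackwardError (h : SRErrorModel μ u δ) (x : ℕ → ℝ) (n : ℕ) {lam : ℝ}
    (hlam : 0 < lam) :
    μ {ω | ¬ IsBackwardSum (range (n + 1)) x (recSum x (fun i => δ i ω) n)
        (lam * Real.sqrt n * u * (1 + u) ^ (n - 1))}
      ≤ ENNReal.ofReal (2 * Real.exp (-lam ^ 2 / 2)) := by
  have hu : 0 ≤ u := u_nonneg h
  have hε : 0 ≤ lam * Real.sqrt n * u * (1 + u) ^ (n - 1) := by positivity
  refine (measure_mono ?_).trans (recSum_probErrorBound h x n hlam)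
  intro ω hω
  simp only [Set.mem_setOf_eq] at hω ⊢
  by_contra hle
  exact hω (isBackwardSum_of_abs_sub_le hε (not_lt.mp hle))

end Probabilistic

end Literature.ComputerArithmetic.HighamMary2020
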